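import Summits.ResolutionOfSingularities.ResolutionOfSingularities.Theorems.PurelyInseparableDim4ResConePairReduction
import HarnessLib
import HarnessLib.Audit.Tags

/-!
# Purely inseparable four-folds — DOCKING THE Φ-LINE INTO THE LOSSY-TAIL ARCHITECTURE: a bounded number of KEEP-h steps
# along a critical letter `h` forces an eventually constant chart word, i.e. a free tail, excluded by FT
# (K2(p) lane, SLICE C (C19); desk WORD #121 «dock the Φ stubs into the lossy-tail architecture»; file-holder res-dim4-p-5 g3;
# the budget itself is res-dim4-idea-1 g5's `PhiLine.keepCount_le_betaS` (Sketch.lean 93ca6328…, (K-Φ1) landed p688119 by p-11 g3))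

[OURS · counted 0 · cell `res-dim4-pi` · K2(p) lane (desk WORDS #78 (d), #80 (d), #96 (b), #105 (d), #121) · seat p-5 g3.]
Nothing here proves K2(p), `NoIsolatedTrap p p` or resolution of singularities in dimension ≥ 4 / char. `p`.

DICTIONARY (idea-1 g5, memo `B-infinity-critical-frame.md`): along a witnessed chain `(c, j, b)` a letter `h` is CRITICAL on the
tail when `p ≤ r_k h + d` for all `k ≥ k₀`; with `d < p` this makes `h` a boundary letter that is NEVER translated
(`critical_not_translated`), so a step either KEEPS `h` as an old component (`j k ≠ h`: idea-1's KEEP-h step, CJS's `u₂`-chart) or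
has chart `h` (LOSE-h, the `u₁`-chart).  The Φ line bounds the number of KEEP-h steps by `β_h·d!` (`PhiLine.keepCount_le_betaS`,
from the tree's `WeightedOrder.betaS_colon_u2_lt` / `betaS_colon_le`, modulo (K-Φ1′)/(K-Φ3)).  THIS FILE is the kernel endpoint
that budget must reach:
* `no_constant_chart_tail` — a witnessed all-isolated chain cannot have a constant chart letter from some time on (no satellite step
  ever again: FT, `FreeTailProof.noIsolatedFreeTailAt_self`);
* `eventually_constant_chart_of_keepCount_le` — a uniform bound on `#{i < n : j (k₀ + i) ≠ h}` makes the chart word eventually `≡ h`;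
* **`no_tail_of_keepCount_le`** — hence NO all-isolated witnessed chain admits a letter `h` and a bound `B` with
  `#{i < n : j (k₀ + i) ≠ h} ≤ B` for all `n`: the DOCK — feed it `B = betaS (a k₀) (J k₀) d` from `PhiLine.keepCount_le_betaS` with
  `keep i ↔ j (k₀ + i) ≠ h`;
* `no_tail_of_eventually_free` / **`no_tail_of_movingKeepCount_le`** — the same dock with a MOVING critical letter `h k`
  (after a LOSE step the newborn component is the critical one, as in idea-1's memo §2): bounded KEEP count ⇒ free tail ⇒ False;
* `critical_not_translated` / `keep_iff_chart_ne` — the dictionary lemmas: a critical letter is never translated, so «KEEP-h» is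
  literally «chart ≠ h» and «LOSE-h» is «chart = h».
[cite: CossartJannsenSaito2020, Thm. 3.14, Lemma 12.2, Lemma 13.4, Thm. 13.7]
bears_on: LADDER-RESOLUTION:D157-DOOR2 (res-dim4-pi · K2(p) = `RidgeBudget.NoAboveFloorTrap p p` · slice C, lossy residual (B∞)).
Supports stmt-ResolutionOfSingularities-16155 (helper).
-/

set_option linter.dupNamespace false -- mandated namespace of this single-conjunct summit

noncomputable section

namespace Summit.ResolutionOfSingularities.ResolutionOfSingularities.Theorems.PIDim4

namespace ResCone

open MvPolynomial Finset
open Literature.AlgebraicGeometry.Resolution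
open Literature.AlgebraicGeometry.Resolution.CentreBlowup
open Literature.AlgebraicGeometry.Resolution.Hauser2010
open Literature.AlgebraicGeometry.Resolution.HauserPerlega2019

variable {K : Type} [Field K]

section KeepBudget

variable (p : ℕ) [Fact p.Prime] [CharP K p] [DecidableEq K]

/-- **NO CONSTANT CHART WORD**: a witnessed chain of isolated `Step0 p` states cannot have the same chart letter at every step
from some time on — such a tail has no satellite step, contradicting FT. [OURS] [cite: CossartJannsenSaito2020, Thm. 3.14] -/
theorem no_constant_chart_tail {c : ℕ → State K} {j : ℕ → Fin 4} {b : ℕ → Fin 4 → K}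
    (hc : ∀ k, IsIsolated p (c k).F ∧ Step0 p (c k) (c (k + 1))) (hw : FreeTail.IsWitnessedChain p c j b)
    {k₁ : ℕ} {h : Fin 4} (hconst : ∀ k, k₁ ≤ k → j k = h) : False := by
  obtain ⟨m, hm⟩ := FreeTailProof.noIsolatedFreeTailAt_self p K c j b k₁ hw (fun n hn hsat =>
    hsat.1 (by rw [hconst n hn, hconst (n + 1) (by omega)]))
  exact hm (hc m).1

omit [Fact p.Prime] [CharP K p] [DecidableEq K] in
/-- A uniform bound on the number of indices `i < n` with `j (k₀ + i) ≠ h` makes the chart word eventually constant `= h`.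
[folklore] -/
theorem eventually_constant_chart_of_keepCount_le {j : ℕ → Fin 4} {k₀ : ℕ} {h : Fin 4} {B : ℕ}
    (hbudget : ∀ n, ((Finset.range n).filter (fun i => j (k₀ + i) ≠ h)).card ≤ B) :
    ∃ k₁, k₀ ≤ k₁ ∧ ∀ k, k₁ ≤ k → j k = h := by
  classical
  by_contra hno
  push Not at hno
  -- then there are at least `B + 1` indices with `j ≠ h`: pick them one after the other
  have hgrow : ∀ m, ∃ n, m ≤ ((Finset.range n).filter (fun i => j (k₀ + i) ≠ h)).card := by
    intro m
    induction m with
    | zero => exact ⟨0, Nat.zero_le _⟩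
    | succ m ih =>
      obtain ⟨n, hn⟩ := ih
      obtain ⟨k, hk, hjk⟩ := hno (k₀ + n) (by omega)
      refine ⟨k - k₀ + 1, ?_⟩
      have hsub : (Finset.range n).filter (fun i => j (k₀ + i) ≠ h) ⊆
          (Finset.range (k - k₀ + 1)).filter (fun i => j (k₀ + i) ≠ h) := by
        intro i hi
        rw [Finset.mem_filter, Finset.mem_range] at hi ⊢
        exact ⟨by omega, hi.2⟩
      have hmem : k - k₀ ∈ (Finset.range (k - k₀ + 1)).filter (fun i => j (k₀ + i) ≠ h) := by
        rw [Finset.mem_filter, Finset.mem_range]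
        exact ⟨by omega, by rw [show k₀ + (k - k₀) = k by omega]; exact hjk⟩
      have hnot : k - k₀ ∉ (Finset.range n).filter (fun i => j (k₀ + i) ≠ h) := by
        rw [Finset.mem_filter, Finset.mem_range]; omega
      have := Finset.card_lt_card (Finset.ssubset_iff_of_subset hsub |>.mpr ⟨k - k₀, hmem, hnot⟩)
      omega
  obtain ⟨n, hn⟩ := hgrow (B + 1)
  have := hbudget n
  omega

/-- **THE DOCK — NO TAIL WITH A BOUNDED NUMBER OF KEEP-h STEPS**: an all-isolated witnessed chain admits no letter `h`, time
`k₀` and bound `B` with `#{i < n : j (k₀ + i) ≠ h} ≤ B` for every `n`.  (Feed `B = β_h·d!` from the Φ line's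
`PhiLine.keepCount_le_betaS` with `keep i ↔ j (k₀ + i) ≠ h`, see `keep_iff_chart_ne`.) [OURS]
[cite: CossartJannsenSaito2020, Thm. 3.14, Lemma 13.4, Thm. 13.7] -/
theorem no_tail_of_keepCount_le {c : ℕ → State K} {j : ℕ → Fin 4} {b : ℕ → Fin 4 → K}
    (hc : ∀ k, IsIsolated p (c k).F ∧ Step0 p (c k) (c (k + 1))) (hw : FreeTail.IsWitnessedChain p c j b)
    {k₀ : ℕ} {h : Fin 4} {B : ℕ} (hbudget : ∀ n, ((Finset.range n).filter (fun i => j (k₀ + i) ≠ h)).card ≤ B) :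
    False := by
  obtain ⟨k₁, -, hconst⟩ := eventually_constant_chart_of_keepCount_le hbudget
  exact no_constant_chart_tail p hc hw hconst

omit [CharP K p] in
/-- **A CRITICAL LETTER IS NEVER TRANSLATED**: if `p ≤ r_k h + d` for all `k ≥ k₀` on a constant-shade-`d < p` tail, then
`b k h = 0` for all `k ≥ k₀` (a translation would reset `r h` to `0 < p − d`). [OURS]
[cite: HauserPerlega2019PRIMS, §2 (transform D′ of D)] -/
theorem critical_not_translated {c : ℕ → State K} {j : ℕ → Fin 4} {b : ℕ → Fin 4 → K}
    (hc : ∀ k, IsIsolated p (c k).F ∧ Step0 p (c k) (c (k + 1))) (hw : FreeTail.IsWitnessedChain p c j b)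
    (hr0 : ∀ e ∈ (c 0).F.support, (c 0).r ≤ e) (hfloor : ∀ k, ordZero (c k).F ≠ p) {k₀ d : ℕ} (hdp : d < p)
    {h : Fin 4} (hcrit : ∀ k, k₀ ≤ k → p ≤ (c k).r h + d) {k : ℕ} (hk : k₀ ≤ k) : b k h = 0 := by
  by_cases hjk : h = j k
  · rw [hjk]; exact (hw k).2.1
  by_contra hb
  obtain ⟨o, ho, -, -⟩ := chain_band p hc hfloor k
  have h0 := step_r_apply_eq_zero_of_ne p (j k) (hw k).2.1 (c k) ho (IsolatedBand.isolated_chain_forall_le hc hr0 k) hjk hb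
  rw [← (hw k).2.2.2.2] at h0
  have := hcrit (k + 1) (by omega)
  omega

omit [CharP K p] in
/-- **KEEP-h = «chart ≠ h»** for a critical letter: since `h` is never translated, the step `k ≥ k₀` keeps the old component `h`
(idea-1's KEEP-h, `r_{k+1} h = r_k h`) iff its chart letter is not `h`; a chart-`h` step REPLACES the component
(`r_{k+1} h = o_k − p`). [OURS] [cite: HauserPerlega2019PRIMS, §2 (transform D′ of D)] -/
theorem keep_iff_chart_ne {c : ℕ → State K} {j : ℕ → Fin 4} {b : ℕ → Fin 4 → K}
    (hc : ∀ k, IsIsolated p (c k).F ∧ Step0 p (c k) (c (k + 1))) (hw : FreeTail.IsWitnessedChain p c j b)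
    (hr0 : ∀ e ∈ (c 0).F.support, (c 0).r ≤ e) (hfloor : ∀ k, ordZero (c k).F ≠ p) {k₀ d : ℕ} (hdp : d < p)
    {h : Fin 4} (hcrit : ∀ k, k₀ ≤ k → p ≤ (c k).r h + d) {k : ℕ} (hk : k₀ ≤ k) (hjk : j k ≠ h) :
    (c (k + 1)).r h = (c k).r h :=
  step_r_apply_of_untranslated p hc hw hr0 hfloor hjk.symm (critical_not_translated p hc hw hr0 hfloor hdp hcrit hk)

/-- **NO TAIL WHOSE CRITICAL LETTER IS KEPT ONLY FINITELY OFTEN — counted form used by the Φ line**: with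
`keep i := (j (k₀ + i) ≠ h)` the hypothesis of `no_tail_of_keepCount_le` is exactly a uniform bound on
`((Finset.range n).filter keep).card`, the quantity bounded by `PhiLine.keepCount_le_betaS`. [OURS · bookkeeping]
[cite: CossartJannsenSaito2020, Lemma 13.4, Thm. 13.7] -/
theorem no_tail_of_keepCount_le' {c : ℕ → State K} {j : ℕ → Fin 4} {b : ℕ → Fin 4 → K}
    (hc : ∀ k, IsIsolated p (c k).F ∧ Step0 p (c k) (c (k + 1))) (hw : FreeTail.IsWitnessedChain p c j b)
    {k₀ : ℕ} {h : Fin 4} (keep : ℕ → Prop) [DecidablePred keep] (hkeep : ∀ i, keep i ↔ j (k₀ + i) ≠ h) {B : ℕ}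
    (hbudget : ∀ n, ((Finset.range n).filter keep).card ≤ B) : False := by
  classical
  refine no_tail_of_keepCount_le p hc hw (k₀ := k₀) (h := h) (B := B) fun n => ?_
  have : (Finset.range n).filter (fun i => j (k₀ + i) ≠ h) = (Finset.range n).filter keep :=
    Finset.filter_congr fun i _ => (hkeep i).symm
  rw [this]
  exact hbudget n

/-- **NO TAIL WHOSE STEPS ARE EVENTUALLY ALL NON-SATELLITE** (FT in the chain's vocabulary): if from `k₁` on every step either
repeats the chart letter or translates the component just born, the chain is a free tail — impossible along isolated states. [OURS]
[cite: CossartJannsenSaito2020, Thm. 3.14] -/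
theorem no_tail_of_eventually_free {c : ℕ → State K} {j : ℕ → Fin 4} {b : ℕ → Fin 4 → K}
    (hc : ∀ k, IsIsolated p (c k).F ∧ Step0 p (c k) (c (k + 1))) (hw : FreeTail.IsWitnessedChain p c j b) {k₁ : ℕ}
    (hfree : ∀ k, k₁ ≤ k → j (k + 1) = j k ∨ b (k + 1) (j k) ≠ 0) : False := by
  obtain ⟨m, hm⟩ := FreeTailProof.noIsolatedFreeTailAt_self p K c j b k₁ hw (fun n hn hsat => by
    rcases hfree n hn with h | h
    · exact hsat.1 h
    · exact h hsat.2)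
  exact hm (hc m).1

/-- **THE DOCK WITH A MOVING CRITICAL LETTER** (idea-1's dictionary in full: after a LOSE step the NEWBORN component is the
critical one): let `h : ℕ → Fin 4` name the critical letter at each time, `KEEP k :↔ (j k ≠ h k ∧ b k (h k) = 0)` (the near point lies
on the strict transform of `E_{h k}`), with `h (k+1) = h k` after a KEEP step and `h (k+1) = j k` (the newborn letter) after a LOSE
step.  A uniform bound on the number of KEEP steps forces, from some time on, LOSE steps only — each of which makes the PREVIOUS step
non-satellite — a free tail, impossible.  (Feed the bound `β·d!` of `PhiLine.keepCount_le_betaS`.) [OURS]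
[cite: CossartJannsenSaito2020, Thm. 3.14, Lemma 13.4, Thm. 13.7] -/
theorem no_tail_of_movingKeepCount_le {c : ℕ → State K} {j : ℕ → Fin 4} {b : ℕ → Fin 4 → K}
    (hc : ∀ k, IsIsolated p (c k).F ∧ Step0 p (c k) (c (k + 1))) (hw : FreeTail.IsWitnessedChain p c j b)
    {k₀ : ℕ} (h : ℕ → Fin 4)
    (hlose : ∀ k, k₀ ≤ k → ¬ (j k ≠ h k ∧ b k (h k) = 0) → h (k + 1) = j k) {B : ℕ}
    (hbudget : ∀ n, ((Finset.range n).filter (fun i => j (k₀ + i) ≠ h (k₀ + i) ∧ b (k₀ + i) (h (k₀ + i)) = 0)).card ≤ B) :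
    False := by
  classical
  -- finitely many KEEP steps: from some `k₁ ≥ k₀` on every step is a LOSE step
  have hev : ∃ k₁, k₀ ≤ k₁ ∧ ∀ k, k₁ ≤ k → ¬ (j k ≠ h k ∧ b k (h k) = 0) := by
    by_contra hno
    push Not at hno
    have hgrow : ∀ m, ∃ n, m ≤ ((Finset.range n).filter
        (fun i => j (k₀ + i) ≠ h (k₀ + i) ∧ b (k₀ + i) (h (k₀ + i)) = 0)).card := by
      intro m
      induction m with
      | zero => exact ⟨0, Nat.zero_le _⟩
      | succ m ih =>
        obtain ⟨n, hn⟩ := ih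
        obtain ⟨k, hk, hjk⟩ := hno (k₀ + n) (by omega)
        refine ⟨k - k₀ + 1, ?_⟩
        have hsub : (Finset.range n).filter (fun i => j (k₀ + i) ≠ h (k₀ + i) ∧ b (k₀ + i) (h (k₀ + i)) = 0) ⊆
            (Finset.range (k - k₀ + 1)).filter (fun i => j (k₀ + i) ≠ h (k₀ + i) ∧ b (k₀ + i) (h (k₀ + i)) = 0) := by
          intro i hi
          rw [Finset.mem_filter, Finset.mem_range] at hi ⊢
          exact ⟨by omega, hi.2⟩
        have hmem : k - k₀ ∈ (Finset.range (k - k₀ + 1)).filter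
            (fun i => j (k₀ + i) ≠ h (k₀ + i) ∧ b (k₀ + i) (h (k₀ + i)) = 0) := by
          rw [Finset.mem_filter, Finset.mem_range, show k₀ + (k - k₀) = k by omega]
          exact ⟨by omega, hjk⟩
        have hnot : k - k₀ ∉ (Finset.range n).filter
            (fun i => j (k₀ + i) ≠ h (k₀ + i) ∧ b (k₀ + i) (h (k₀ + i)) = 0) := by
          rw [Finset.mem_filter, Finset.mem_range]; omega
        have := Finset.card_lt_card (Finset.ssubset_iff_of_subset hsub |>.mpr ⟨k - k₀, hmem, hnot⟩)
        omega
    obtain ⟨n, hn⟩ := hgrow (B + 1)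
    have := hbudget n
    omega
  obtain ⟨k₁, hk₁, hL⟩ := hev
  -- from `k₁ + 1` on, the critical letter is the previous chart letter, and the step is a LOSE step: the previous step is free
  refine no_tail_of_eventually_free p hc hw (k₁ := k₁) fun k hk => ?_
  have hh : h (k + 1) = j k := hlose k (by omega) (hL k hk)
  have hnext := hL (k + 1) (by omega)
  rw [hh] at hnext
  by_cases hj : j (k + 1) = j k
  · exact Or.inl hj
  · right
    intro hb
    exact hnext ⟨hj, hb⟩

end KeepBudget

end ResCone

end Summit.ResolutionOfSingularities.ResolutionOfSingularities.Theorems.PIDim4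

end
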